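import Summits.BirchSwinnertonDyer.BirchSwinnertonDyer.Theorems.EdgeCap.Negative.FibreStrassmann
import Literature.NumberTheory.EllipticCurves.PAdicHeightsLogProofs
import Mathlib.NumberTheory.Padics.ProperSpace
import Mathlib.NumberTheory.Padics.PadicVal.Basic

/-!
# Crux `TangentCone.EdgeCap` (stmt-BirchSwinnertonDyer-17609), line `ratio_measure_strassmann` —
# layer U: the uniform reference bound for integral two-variable `p`-adic series

Helper file (`--supports stmt-BirchSwinnertonDyer-17609`) of the lead prover of line `ratio_measure_strassmann`
(skeleton `Cruxes/EdgeCap/Lines/ratio_measure_strassmann.lean`; layer U was proved in-file by the crux strategist,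
v3, and is landed here verbatim so that stub workers and the composition `EdgeCap_of` can import it).

Content (pure `p`-adic analysis over the tree's `padicEval₂` / `IsPadicInt`, no arithmetic):

* `norm_natCast_mul_pow_padicValNat` — `‖t‖_p · p^{v_p(t)} = 1`;
* `norm_padicEval₂_sub_le` — the 1-Lipschitz estimate `‖F(x,y) − F(x',y)‖ ≤ ‖x − x'‖` in the weight variable;
* `uniformReference` — pointwise non-vanishing of the weight fibres at cyclotomic reference points
  `y_j = (1+p)^{j−1} − 1` (`j` odd, `≥ 3`, `j ≡ 1 (mod p−1)`) upgrades to a UNIFORM lower bound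
  `1 ≤ ‖F(x, y_j)‖ · p^C` with `j ≤ 2J+1`, by ultrametric local constancy and compactness of `pℤ_p`
  (the 2001 programme's "reference index by compactness of weight space", its Thm B, which has no printed counterpart).

Reused (not restated): `EdgeCap.Negative.norm_one_add_pow_sub_one_lt`, `EdgeCap.Negative.summable_of_le_geometric₂`
(`Theorems/EdgeCap/Negative/FibreStrassmann.lean`, landed by the crux's disprover) and
`Literature.NumberTheory.EllipticCurves.norm_le_inv_of_norm_lt_one`.
No definitions. References: standard ultrametric analysis [folklore]; compactness of `ℤ_p` (Mathlib `ProperSpace ℚ_[p]`).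
-/

-- The directory layout `Summits/BirchSwinnertonDyer/BirchSwinnertonDyer/…` forces the duplicated segment.
set_option linter.dupNamespace false

noncomputable section

namespace Summit.BirchSwinnertonDyer.BirchSwinnertonDyer.Theorems.TangentConeEdgeCap

open Literature.NumberTheory.EllipticCurves
open Summit.BirchSwinnertonDyer.BirchSwinnertonDyer.Theorems.EdgeCap.Negative

/-! ## Elementary lemmas -/

/-- `‖t‖_p · p^{v_p(t)} = 1` for a non-zero natural number `t`. [folklore] -/
theorem norm_natCast_mul_pow_padicValNat (p : ℕ) [Fact p.Prime] {t : ℕ} (ht : t ≠ 0) :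
    ‖(t : ℚ_[p])‖ * (p : ℝ) ^ padicValNat p t = 1 := by
  have ht' : (t : ℚ_[p]) ≠ 0 := by exact_mod_cast ht
  have hp0 : (p : ℝ) ≠ 0 := by exact_mod_cast (Fact.out : p.Prime).ne_zero
  rw [Padic.norm_eq_zpow_neg_valuation ht', Padic.valuation_natCast, ← zpow_natCast, ← zpow_add₀ hp0]
  simp

/-! ## Layer U: the uniform reference bound -/

section LayerU

variable {p : ℕ} [Fact p.Prime]

/-- `‖x^n − x'^n‖ ≤ ‖x − x'‖` in the closed unit disc (ultrametric). -/
theorem norm_pow_sub_pow_le {x x' : ℚ_[p]} (hx : ‖x‖ ≤ 1) (hx' : ‖x'‖ ≤ 1) (n : ℕ) :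
    ‖x ^ n - x' ^ n‖ ≤ ‖x - x'‖ := by
  induction n with
  | zero => simp
  | succ n ih =>
    have hrw : x ^ (n + 1) - x' ^ (n + 1) = x * (x ^ n - x' ^ n) + (x - x') * x' ^ n := by ring
    rw [hrw]
    calc ‖x * (x ^ n - x' ^ n) + (x - x') * x' ^ n‖
        ≤ max ‖x * (x ^ n - x' ^ n)‖ ‖(x - x') * x' ^ n‖ := IsUltrametricDist.norm_add_le_max _ _
      _ ≤ ‖x - x'‖ := by
          refine max_le ?_ ?_
          · rw [norm_mul]
            calc ‖x‖ * ‖x ^ n - x' ^ n‖ ≤ 1 * ‖x - x'‖ := by gcongr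
              _ = ‖x - x'‖ := one_mul _
          · rw [norm_mul, norm_pow]
            calc ‖x - x'‖ * ‖x'‖ ^ n ≤ ‖x - x'‖ * 1 := by
                  gcongr; exact pow_le_one₀ (norm_nonneg _) hx'
              _ = ‖x - x'‖ := mul_one _

/-- **Continuity estimate in the weight variable**: `‖F(x,y) − F(x',y)‖ ≤ ‖x − x'‖` for integral `F`
and `x, x', y` in the open unit disc. -/
theorem norm_padicEval₂_sub_le {F : MvPowerSeries (Fin 2) ℚ_[p]} (hF : IsPadicInt F)
    {x x' y : ℚ_[p]} (hx : ‖x‖ < 1) (hx' : ‖x'‖ < 1) (hy : ‖y‖ < 1) :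
    ‖padicEval₂ F x y - padicEval₂ F x' y‖ ≤ ‖x - x'‖ := by
  have hsx : Summable fun d : Fin 2 →₀ ℕ => MvPowerSeries.coeff d F * (x ^ d 0 * y ^ d 1) :=
    summable_of_le_geometric₂ (K := 1) hx hy fun d => by
      rw [norm_mul, norm_mul, norm_pow, norm_pow, one_mul]
      exact mul_le_of_le_one_left (by positivity) (hF d)
  have hsx' : Summable fun d : Fin 2 →₀ ℕ => MvPowerSeries.coeff d F * (x' ^ d 0 * y ^ d 1) :=
    summable_of_le_geometric₂ (K := 1) hx' hy fun d => by
      rw [norm_mul, norm_mul, norm_pow, norm_pow, one_mul]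
      exact mul_le_of_le_one_left (by positivity) (hF d)
  unfold padicEval₂
  rw [← hsx.tsum_sub hsx']
  refine IsUltrametricDist.norm_tsum_le_of_forall_le_of_nonneg (norm_nonneg _) fun d => ?_
  have hrw : MvPowerSeries.coeff d F * (x ^ d 0 * y ^ d 1) - MvPowerSeries.coeff d F * (x' ^ d 0 * y ^ d 1)
      = MvPowerSeries.coeff d F * ((x ^ d 0 - x' ^ d 0) * y ^ d 1) := by ring
  rw [hrw, norm_mul, norm_mul, norm_pow]
  calc ‖MvPowerSeries.coeff d F‖ * (‖x ^ d 0 - x' ^ d 0‖ * ‖y‖ ^ d 1)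
      ≤ 1 * (‖x - x'‖ * 1) := by
        gcongr
        · exact hF d
        · exact norm_pow_sub_pow_le hx.le hx'.le _
        · exact pow_le_one₀ (norm_nonneg _) hy.le
    _ = ‖x - x'‖ := by ring

/-- **U · `uniformReference` (PROVED here; was stub U of v1/v2)** — pointwise non-vanishing at some
cyclotomic point `y_j = (1+p)^{j−1} − 1` (`j` odd, `≥ 3`, `≡ 1 mod p−1`) upgrades to a UNIFORM reference
lower bound on the weight disc: ultrametric continuity in `x` (`norm_padicEval₂_sub_le`), local constancy of
a non-zero norm, compactness of the disc `{‖x‖ < 1} = closedBall 0 p⁻¹` (`ProperSpace ℚ_[p]`), finite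
subcover. This is the 2001 programme's "reference `j` by compactness of weight space" (its Thm B), which has
no printed counterpart. [folklore] -/
theorem uniformReference' (p : ℕ) [Fact p.Prime] (F : MvPowerSeries (Fin 2) ℚ_[p]) (hF : IsPadicInt F)
    (h : ∀ x : ℚ_[p], ‖x‖ < 1 →
      ∃ j : ℕ, Odd j ∧ 3 ≤ j ∧ (p - 1) ∣ (j - 1) ∧ padicEval₂ F x ((1 + (p : ℚ_[p])) ^ (j - 1) - 1) ≠ 0) :
    ∃ J C : ℕ, ∀ x : ℚ_[p], ‖x‖ < 1 →
      ∃ j : ℕ, Odd j ∧ 3 ≤ j ∧ (p - 1) ∣ (j - 1) ∧ j ≤ 2 * J + 1 ∧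
        1 ≤ ‖padicEval₂ F x ((1 + (p : ℚ_[p])) ^ (j - 1) - 1)‖ * (p : ℝ) ^ C := by
  classical
  -- notation
  set y : ℕ → ℚ_[p] := fun j => (1 + (p : ℚ_[p])) ^ (j - 1) - 1 with hy
  have hy1 : ∀ j, ‖y j‖ < 1 := fun j => norm_one_add_pow_sub_one_lt p _
  have hp1 : (1 : ℝ) < p := by exact_mod_cast (Fact.out : p.Prime).one_lt
  -- the compact disc
  set K : Set ℚ_[p] := Metric.closedBall 0 ((p : ℝ)⁻¹) with hK
  have hKc : IsCompact K := isCompact_closedBall _ _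
  have hmemK : ∀ x : ℚ_[p], ‖x‖ < 1 → x ∈ K := fun x hx => by
    rw [hK, Metric.mem_closedBall, dist_zero_right]; exact norm_le_inv_of_norm_lt_one hx
  have hKlt : ∀ x ∈ K, ‖x‖ < 1 := fun x hx => by
    rw [hK, Metric.mem_closedBall, dist_zero_right] at hx
    exact hx.trans_lt (inv_lt_one_of_one_lt₀ hp1)
  -- pointwise choices
  choose! jx hjodd hj3 hjp hjne using fun x (hx : x ∈ K) => h x (hKlt x hx)
  set ε : ℚ_[p] → ℝ := fun x => ‖padicEval₂ F x (y (jx x))‖ with hε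
  have hεpos : ∀ x ∈ K, 0 < ε x := fun x hx => norm_pos_iff.mpr (hjne x hx)
  -- finite subcover by the balls `B(x₀, ε x₀)`
  obtain ⟨t, htK, hcover⟩ := hKc.elim_nhds_subcover (fun x => Metric.ball x (ε x))
    (fun x hx => Metric.ball_mem_nhds x (hεpos x hx))
  -- exponents making `ε x₀ · p^n ≥ 1`
  have hn : ∀ x₀ ∈ t, ∃ n : ℕ, 1 ≤ ε x₀ * (p : ℝ) ^ n := by
    intro x₀ hx₀
    obtain ⟨n, hn⟩ := pow_unbounded_of_one_lt (ε x₀)⁻¹ hp1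
    refine ⟨n, ?_⟩
    have hε0 := hεpos x₀ (htK x₀ hx₀)
    have : (ε x₀)⁻¹ * ε x₀ ≤ (p : ℝ) ^ n * ε x₀ := by
      exact mul_le_mul_of_nonneg_right hn.le hε0.le
    rw [inv_mul_cancel₀ hε0.ne'] at this
    linarith [mul_comm ((p : ℝ) ^ n) (ε x₀)]
  choose! nx hnx using hn
  refine ⟨t.sup jx, t.sup nx, fun x hx => ?_⟩
  -- locate `x` in a ball of the cover
  have hxU := hcover (hmemK x hx)
  simp only [Set.mem_iUnion] at hxU
  obtain ⟨x₀, hx₀t, hxball⟩ := hxU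
  have hx₀K : x₀ ∈ K := htK x₀ hx₀t
  refine ⟨jx x₀, hjodd x₀ hx₀K, hj3 x₀ hx₀K, hjp x₀ hx₀K, ?_, ?_⟩
  · exact (Finset.le_sup hx₀t).trans (by omega)
  · -- `‖F(x, y)‖ = ‖F(x₀, y)‖` by the continuity estimate and the ultrametric property
    have hdist : ‖x - x₀‖ < ε x₀ := by rwa [Metric.mem_ball, dist_eq_norm] at hxball
    have hclose : ‖padicEval₂ F x (y (jx x₀)) - padicEval₂ F x₀ (y (jx x₀))‖
        < ‖padicEval₂ F x₀ (y (jx x₀))‖ :=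
      (norm_padicEval₂_sub_le hF hx (hKlt x₀ hx₀K) (hy1 _)).trans_lt hdist
    have heq : ‖padicEval₂ F x (y (jx x₀))‖ = ‖padicEval₂ F x₀ (y (jx x₀))‖ :=
      Padic.norm_eq_of_norm_sub_lt_right hclose
    have hpow : (p : ℝ) ^ nx x₀ ≤ (p : ℝ) ^ t.sup nx :=
      pow_le_pow_right₀ hp1.le (Finset.le_sup hx₀t)
    show 1 ≤ ‖padicEval₂ F x (y (jx x₀))‖ * (p : ℝ) ^ t.sup nx
    rw [heq]
    calc (1 : ℝ) ≤ ε x₀ * (p : ℝ) ^ nx x₀ := hnx x₀ hx₀t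
      _ ≤ ε x₀ * (p : ℝ) ^ t.sup nx := mul_le_mul_of_nonneg_left hpow (norm_nonneg _)


/-- **U · `uniformReference`** (registered stub form of `uniformReference'`, verbatim signature): pointwise non-vanishing
of the weight fibres at cyclotomic reference points upgrades to a uniform reference lower bound. -/
theorem uniformReference :
    ∀ (p : ℕ) [Fact p.Prime] (F : MvPowerSeries (Fin 2) ℚ_[p]), Literature.NumberTheory.EllipticCurves.IsPadicInt F → (∀ x : ℚ_[p], ‖x‖ < 1 → ∃ j : ℕ, Odd j ∧ 3 ≤ j ∧ (p - 1) ∣ (j - 1) ∧ Literature.NumberTheory.EllipticCurves.padicEval₂ F x ((1 + (p : ℚ_[p])) ^ (j - 1) - 1) ≠ 0) → ∃ J C : ℕ, ∀ x : ℚ_[p], ‖x‖ < 1 → ∃ j : ℕ, Odd j ∧ 3 ≤ j ∧ (p - 1) ∣ (j - 1) ∧ j ≤ 2 * J + 1 ∧ 1 ≤ ‖Literature.NumberTheory.EllipticCurves.padicEval₂ F x ((1 + (p : ℚ_[p])) ^ (j - 1) - 1)‖ * (p : ℝ) ^ C :=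
  fun p _ F hF h => uniformReference' p F hF h

end LayerU

end Summit.BirchSwinnertonDyer.BirchSwinnertonDyer.Theorems.TangentConeEdgeCap

end
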